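import Literature.MathematicalPhysics.QuantumManyBody.BoseGasFreeDirichletBEC
import Literature.MathematicalPhysics.QuantumManyBody.PeriodicBoseGasFourier
import HarnessLib

/-!
# `BecUvTail` (stmt-AtomisticToContinuum-8823), line `Sketch` — registered stub `stub_liftOneBody`

Helper for the crux skeleton `Cruxes/BecUvTail/Lines/Sketch.lean` of route `BECInfraredBound`
(`AtomisticToContinuum/BoseEinsteinCondensation`): proves the registered stub `stub_liftOneBody` verbatim.
It is the `N`-body lift of a one-body ultraviolet inequality: GIVEN (i) a one-body bound
`ℓ³ ∑_{k : K' < ‖k‖} |ĉ_k(u)|² ≤ c₀ ∫_{[0,ℓ)³} |u|² + A (ℓ/K')² ∫_{[0,ℓ)³} |∇u|²` for every `C¹`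
function `u` on `ℝ³` (`ĉ_k` the Fourier coefficients of the cell `[0,ℓ)³`), and (ii) the slice formula
for the occupation of the window plane waves `w_k = ℓ^{-3/2} 1_{(εL, L-εL)³} e^{2πi k·x/ℓ}`,
`ℓ = (1-2ε)L`, namely `⟨w_k, γ_Ψ w_k⟩ = N ∫ dY ℓ³ |ĉ_k(x ↦ Ψ(x + a, Y))|²`, `a = (εL, εL, εL)`, it proves
for every Dirichlet trial state `Ψ` of `Λ_L^N` the bound
`∑_{k : K' < ‖k‖} ⟨w_k, γ_Ψ w_k⟩ ≤ c₀ N + A (ℓ/K')² T(Ψ)`, `T(Ψ) = ∫ |∇Ψ|²`.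
Proof (the bookkeeping of `BoseGasFreeDirichletBEC.key_inequality`): rewrite every summand by (ii),
pull `N` and `∫ dY` through the sum (Tonelli for sums, `lintegral_tsum`; the summands are measurable in
`Y` because `ĉ_k` is a parametrised Bochner integral of a continuous integrand), apply (i) to each
slice `u_Y(x) = Ψ(x + a, Y)` (a `C¹` function), bound the translated cell integrals of `|u_Y|²` and
`|∇u_Y|²` by the full-space integrals of the slice `x ↦ Ψ(x, Y)` (translation covariance of the
integral and of `|∇·|²`), integrate over `Y` (`∫ dY ∫ dx |Ψ(x,Y)|² = 1`,
`∫ dY ∫ dx |∇ₓΨ(x,Y)|² = ∫ |∇₀Ψ|²`) and use Bose symmetry `N ∫ |∇₀Ψ|² = T(Ψ)`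
(`lintegral_kineticDensity_eq_mul`). Sources: [LSSY2005] E. H. Lieb, R. Seiringer, J. P. Solovej,
J. Yngvason, *The Mathematics of the Bose Gas and its Condensation* (2005), §1.2 (1.17)–(1.18)
(one-particle density matrix through slices); folklore.
-/

noncomputable section

open MeasureTheory Filter
open scoped ENNReal NNReal BigOperators ComplexConjugate

namespace Summit.AtomisticToContinuum.BoseEinsteinCondensation.Theorems.BecUvTail

open Literature.MathematicalPhysics.QuantumManyBody.BoseGas

/-- Measurability in the spectator variables `Y` of the cell Fourier coefficient
`ĉ_k(x ↦ Ψ(x + a, Y))` of a translated slice of a continuous `Ψ` (a parametrised Bochner integral of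
the continuous integrand `conj(e_k(x)) Ψ(x + a, Y)` over the cell). [folklore] -/
private theorem measurable_cellFourierCoeff_slice {n : ℕ} {ℓ : ℝ} (hℓ : 0 < ℓ)
    {Ψ : Config (n + 1) → ℂ} (hΨ : Continuous Ψ) (a : Space) (k : Fin 3 → ℤ) :
    Measurable fun Y : Config n => cellFourierCoeff ℓ (fun x => Ψ (Matrix.vecCons (x + a) Y)) k := by
  have hSM : StronglyMeasurable (Function.uncurry fun (Y : Config n) (x : Space) =>
      conj (cellWave ℓ k x) * Ψ (Matrix.vecCons (x + a) Y)) :=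
    ((Complex.continuous_conj.comp ((contDiff_cellWave ℓ k).continuous.comp continuous_snd)).mul
      (hΨ.comp ((continuous_snd.add continuous_const).matrixVecCons continuous_fst))).stronglyMeasurable
  have h2 : StronglyMeasurable fun Y : Config n =>
      ∫ x in cell ℓ, conj (cellWave ℓ k x) * Ψ (Matrix.vecCons (x + a) Y) :=
    hSM.integral_prod_right' (ν := volume.restrict (cell ℓ))
  simp only [cellFourierCoeff_eq_integral hℓ]
  exact (h2.const_smul ((ℓ ^ 3)⁻¹ : ℝ)).measurable

/-- `∫ dY ∫ dx |Ψ(x, Y)|² = 1` for a normalised state (Tonelli). [folklore] -/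
private theorem lintegral_lintegral_sliceSq {n : ℕ} {L : ℝ} (Ψ : TrialState (n + 1) L) :
    ∫⁻ Y : Config n, ∫⁻ x, (‖Ψ.ψ (Matrix.vecCons x Y)‖₊ : ℝ≥0∞) ^ 2 = 1 := by
  have hF : Measurable fun X : Config (n + 1) => (‖Ψ.ψ X‖₊ : ℝ≥0∞) ^ 2 :=
    measurable_normSq Ψ.contDiff.continuous
  have hsw : AEMeasurable (Function.uncurry fun (Y : Config n) (x : Space) =>
      (‖Ψ.ψ (Matrix.vecCons x Y)‖₊ : ℝ≥0∞) ^ 2) (volume.prod volume) :=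
    ((hF.comp measurable_vecCons).comp measurable_swap).aemeasurable
  rw [lintegral_lintegral_swap hsw, lintegral_lintegral_vecCons hF, Ψ.norm_eq]

/-- **The lift, abstract form.** If a one-body inequality
`ℓ³ ∑_{k : p k} |ĉ_k(u)|² ≤ c ∫_{[0,ℓ)³} |u|² + A ∫_{[0,ℓ)³} |∇u|²` holds for every `C¹` function `u`,
then for every Dirichlet trial state `Ψ` of `N = n + 1` bosons and every translation `a`,
`∑_{k : p k} N ∫ dY ℓ³ |ĉ_k(x ↦ Ψ(x + a, Y))|² ≤ c N + A T(Ψ)`: apply the inequality to each slice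
`u_Y(x) = Ψ(x + a, Y)`, bound the cell integrals of the translate by full-space integrals of the slice,
integrate over `Y` and use `∫|Ψ|² = 1` and Bose symmetry `N ∫ |∇₀Ψ|² = T(Ψ)`. [folklore] -/
private theorem tsum_lintegral_cellFourierCoeff_slice_le {n : ℕ} {L ℓ : ℝ} (hℓ : 0 < ℓ) (a : Space)
    (p : (Fin 3 → ℤ) → Prop) (c A : ℝ≥0∞) (Ψ : TrialState (n + 1) L)
    (hOB : ∀ u : Space → ℂ, ContDiff ℝ 1 u →
      ENNReal.ofReal ℓ ^ 3 * ∑' k : {m : Fin 3 → ℤ // p m},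
          (‖cellFourierCoeff ℓ u (k : Fin 3 → ℤ)‖₊ : ℝ≥0∞) ^ 2 ≤
        c * (∫⁻ x in cell ℓ, (‖u x‖₊ : ℝ≥0∞) ^ 2) + A * ∫⁻ x in cell ℓ, gradSqC u x) :
    ∑' k : {m : Fin 3 → ℤ // p m}, (n + 1 : ℝ≥0∞) * ∫⁻ Y : Config n, ENNReal.ofReal ℓ ^ 3 *
        (‖cellFourierCoeff ℓ (fun x => Ψ.ψ (Matrix.vecCons (x + a) Y)) (k : Fin 3 → ℤ)‖₊ : ℝ≥0∞) ^ 2 ≤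
      c * (n + 1 : ℝ≥0∞) + A * ∫⁻ X, kineticDensity Ψ.ψ X := by
  have hcont : Continuous Ψ.ψ := Ψ.contDiff.continuous
  have hdiff : Differentiable ℝ Ψ.ψ := Ψ.contDiff.differentiable one_ne_zero
  -- measurability of the summands in `Y`
  have hmeas : ∀ k : {m : Fin 3 → ℤ // p m}, Measurable fun Y : Config n => ENNReal.ofReal ℓ ^ 3 *
      (‖cellFourierCoeff ℓ (fun x => Ψ.ψ (Matrix.vecCons (x + a) Y)) (k : Fin 3 → ℤ)‖₊ : ℝ≥0∞) ^ 2 :=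
    fun k => ((measurable_cellFourierCoeff_slice hℓ hcont a k.1).nnnorm.coe_nnreal_ennreal.pow_const
      _).const_mul _
  -- the one-body inequality on each slice, with the cell integrals bounded by full-space ones
  have hY : ∀ Y : Config n, ENNReal.ofReal ℓ ^ 3 * ∑' k : {m : Fin 3 → ℤ // p m},
      (‖cellFourierCoeff ℓ (fun x => Ψ.ψ (Matrix.vecCons (x + a) Y)) (k : Fin 3 → ℤ)‖₊ : ℝ≥0∞) ^ 2 ≤
      c * (∫⁻ x, (‖Ψ.ψ (Matrix.vecCons x Y)‖₊ : ℝ≥0∞) ^ 2) +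
        A * ∫⁻ x, gradSqC (fun y => Ψ.ψ (Matrix.vecCons y Y)) x := by
    intro Y
    have hu : ContDiff ℝ 1 (fun x => Ψ.ψ (Matrix.vecCons (x + a) Y)) :=
      (contDiff_vecCons_slice Ψ.contDiff Y).comp (contDiff_id.add contDiff_const)
    refine (hOB _ hu).trans (add_le_add (mul_le_mul_right ?_ _) (mul_le_mul_right ?_ _))
    · calc ∫⁻ x in cell ℓ, (‖Ψ.ψ (Matrix.vecCons (x + a) Y)‖₊ : ℝ≥0∞) ^ 2
          = ∫⁻ x in cellShift ℓ a, (‖Ψ.ψ (Matrix.vecCons x Y)‖₊ : ℝ≥0∞) ^ 2 :=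
            setLIntegral_cell_comp_add ℓ (fun x => (‖Ψ.ψ (Matrix.vecCons x Y)‖₊ : ℝ≥0∞) ^ 2) a
        _ ≤ _ := setLIntegral_le_lintegral _ _
    · calc ∫⁻ x in cell ℓ, gradSqC (fun x => Ψ.ψ (Matrix.vecCons (x + a) Y)) x
          = ∫⁻ x in cell ℓ, gradSqC (fun y => Ψ.ψ (Matrix.vecCons y Y)) (x + a) :=
            lintegral_congr fun x => gradSqC_comp_add (fun y => Ψ.ψ (Matrix.vecCons y Y)) a x
        _ = ∫⁻ x in cellShift ℓ a, gradSqC (fun y => Ψ.ψ (Matrix.vecCons y Y)) x :=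
            setLIntegral_cell_comp_add ℓ _ a
        _ ≤ _ := setLIntegral_le_lintegral _ _
  -- measurability of the two majorants
  have hF : Measurable fun q : Space × Config n => (‖Ψ.ψ (Matrix.vecCons q.1 q.2)‖₊ : ℝ≥0∞) ^ 2 :=
    (measurable_normSq hcont).comp measurable_vecCons
  have hm : Measurable fun Y : Config n => ∫⁻ x, (‖Ψ.ψ (Matrix.vecCons x Y)‖₊ : ℝ≥0∞) ^ 2 :=
    hF.lintegral_prod_left'
  have hg : Measurable fun Y : Config n => ∫⁻ x, gradSqC (fun y => Ψ.ψ (Matrix.vecCons y Y)) x :=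
    measurable_lintegral_gradSqC_vecCons hdiff
  -- integrate over `Y`
  have hint : ∫⁻ Y : Config n, ENNReal.ofReal ℓ ^ 3 * ∑' k : {m : Fin 3 → ℤ // p m},
      (‖cellFourierCoeff ℓ (fun x => Ψ.ψ (Matrix.vecCons (x + a) Y)) (k : Fin 3 → ℤ)‖₊ : ℝ≥0∞) ^ 2 ≤
      c * 1 + A * ∫⁻ X, partialGradSq 0 Ψ.ψ X := by
    refine (lintegral_mono hY).trans (le_of_eq ?_)
    rw [lintegral_add_left (hm.const_mul c), lintegral_const_mul c hm, lintegral_const_mul A hg,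
      lintegral_lintegral_sliceSq Ψ, ← lintegral_partialGradSq_zero_eq hdiff]
  -- assemble and multiply by `N`
  calc ∑' k : {m : Fin 3 → ℤ // p m}, (n + 1 : ℝ≥0∞) * ∫⁻ Y : Config n, ENNReal.ofReal ℓ ^ 3 *
          (‖cellFourierCoeff ℓ (fun x => Ψ.ψ (Matrix.vecCons (x + a) Y)) (k : Fin 3 → ℤ)‖₊ : ℝ≥0∞) ^ 2
      = (n + 1 : ℝ≥0∞) * ∫⁻ Y : Config n, ∑' k : {m : Fin 3 → ℤ // p m}, ENNReal.ofReal ℓ ^ 3 *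
          (‖cellFourierCoeff ℓ (fun x => Ψ.ψ (Matrix.vecCons (x + a) Y)) (k : Fin 3 → ℤ)‖₊ : ℝ≥0∞) ^ 2 := by
        rw [ENNReal.tsum_mul_left, ← lintegral_tsum fun k => (hmeas k).aemeasurable]
    _ = (n + 1 : ℝ≥0∞) * ∫⁻ Y : Config n, ENNReal.ofReal ℓ ^ 3 * ∑' k : {m : Fin 3 → ℤ // p m},
          (‖cellFourierCoeff ℓ (fun x => Ψ.ψ (Matrix.vecCons (x + a) Y)) (k : Fin 3 → ℤ)‖₊ : ℝ≥0∞) ^ 2 := by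
        simp only [ENNReal.tsum_mul_left]
    _ ≤ (n + 1 : ℝ≥0∞) * (c * 1 + A * ∫⁻ X, partialGradSq 0 Ψ.ψ X) := mul_le_mul_right hint _
    _ = c * (n + 1 : ℝ≥0∞) + A * ((n + 1 : ℝ≥0∞) * ∫⁻ X, partialGradSq 0 Ψ.ψ X) := by ring
    _ = c * (n + 1 : ℝ≥0∞) + A * ∫⁻ X, kineticDensity Ψ.ψ X := by
        rw [lintegral_kineticDensity_eq_mul hdiff Ψ.symm]

/-- **`N`-body lift of the one-body ultraviolet inequality** (registered stub `stub_liftOneBody` of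
stmt-AtomisticToContinuum-8823, verbatim). Given constants `c₀, A ≥ 0`, `M`, a one-body bound
`ℓ³ ∑_{k : K' < ‖k‖} |ĉ_k(u)|² ≤ c₀ ∫_{[0,ℓ)³}|u|² + A(ℓ/K')² ∫_{[0,ℓ)³}|∇u|²` (`ℓ > 0`, `K' ≥ M`,
`u ∈ C¹`) and the slice formula `⟨w_k, γ_Ψ w_k⟩ = N ∫ dY ℓ³ |ĉ_k(x ↦ Ψ(x + a, Y))|²` for the window
plane waves `w_k` of the inner box `(εL, L-εL)³` (`ℓ = (1-2ε)L`, `a = (εL,εL,εL)`), every Dirichlet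
trial state `Ψ` of `N = n+1` bosons in `Λ_L` obeys
`∑_{k : K' < ‖k‖} ⟨w_k, γ_Ψ w_k⟩ ≤ c₀ N + A (ℓ/K')² ∫ |∇Ψ|²`. Proof: rewrite by the slice formula,
exchange sum and integrals, apply the one-body bound to each slice `u_Y(x) = Ψ(x + a, Y)`, dominate the
translated cell integrals by full-space slice integrals, integrate over `Y` (`∫|Ψ|² = 1`) and use Bose
symmetry `N ∫|∇₀Ψ|² = ∫|∇Ψ|²` (template: `BoseGasFreeDirichletBEC.key_inequality`). [folklore] -/
theorem stub_liftOneBody :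
    ∀ (c₀ A M : ℝ), 0 ≤ c₀ → 0 ≤ A → (∀ (ℓ K' : ℝ) (u : EuclideanSpace ℝ (Fin 3) → ℂ), 0 < ℓ → M ≤ K' → ContDiff ℝ 1 u → ENNReal.ofReal ℓ ^ 3 * ∑' n : {n : Fin 3 → ℤ // K' < ‖(fun j => (n j : ℝ))‖}, (‖Literature.MathematicalPhysics.QuantumManyBody.BoseGas.cellFourierCoeff ℓ u (n : Fin 3 → ℤ)‖₊ : ENNReal) ^ 2 ≤ ENNReal.ofReal c₀ * (∫⁻ x in Literature.MathematicalPhysics.QuantumManyBody.BoseGas.cell ℓ, (‖u x‖₊ : ENNReal) ^ 2) + ENNReal.ofReal (A * (ℓ / K') ^ 2) * ∫⁻ x in Literature.MathematicalPhysics.QuantumManyBody.BoseGas.cell ℓ, Literature.MathematicalPhysics.QuantumManyBody.BoseGas.gradSqC u x) → (∀ (n : ℕ) (L ε : ℝ) (k : Fin 3 → ℤ) (Ψ : (Fin (n + 1) → EuclideanSpace ℝ (Fin 3)) → ℂ), 0 < L → 0 < ε → ε < 1 / 4 → Literature.MathematicalPhysics.QuantumManyBody.BoseGas.occupation (n + 1)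 ({x : EuclideanSpace ℝ (Fin 3) | ∀ j, x j ∈ Set.Ioo (ε * L) (L - ε * L)}.indicator fun x => ((Real.sqrt (((1 - 2 * ε) * L) ^ 3))⁻¹ : ℂ) * Complex.exp (Complex.I * ↑(2 * Real.pi / ((1 - 2 * ε) * L) * ∑ j, (k j : ℝ) * x j))) Ψ = (n + 1 : ENNReal) * ∫⁻ Y : Fin n → EuclideanSpace ℝ (Fin 3), ENNReal.ofReal ((1 - 2 * ε) * L) ^ 3 * (‖Literature.MathematicalPhysics.QuantumManyBody.BoseGas.cellFourierCoeff ((1 - 2 * ε) * L) (fun x => Ψ (Matrix.vecCons (x + (WithLp.toLp 2 (fun _ : Fin 3 => ε * L) : EuclideanSpace ℝ (Fin 3))) Y)) k‖₊ : ENNReal) ^ 2) → ∀ (n : ℕ) (L ε K' : ℝ) (Ψ : Literature.MathematicalPhysics.QuantumManyBody.BoseGas.TrialState (n + 1) L), 0 < L → 0 < ε → ε < 1 / 4 → M ≤ K' → ∑' k : {n : Fin 3 → ℤ // K' < ‖(fun j => (n j : ℝ))‖}, Literature.MathematicalPhysics.QuantumManyBody.BoseGas.occupation (n + 1) ({x :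 EuclideanSpace ℝ (Fin 3) | ∀ j, x j ∈ Set.Ioo (ε * L) (L - ε * L)}.indicator fun x => ((Real.sqrt (((1 - 2 * ε) * L) ^ 3))⁻¹ : ℂ) * Complex.exp (Complex.I * ↑(2 * Real.pi / ((1 - 2 * ε) * L) * ∑ j, ((k : Fin 3 → ℤ) j : ℝ) * x j))) Ψ.ψ ≤ ENNReal.ofReal c₀ * (n + 1 : ENNReal) + ENNReal.ofReal (A * ((1 - 2 * ε) * L / K') ^ 2) * ∫⁻ X, Literature.MathematicalPhysics.QuantumManyBody.BoseGas.kineticDensity Ψ.ψ X := by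
  intro c₀ A M _ _ hOB hW n L ε K' Ψ hL hε hε4 hMK
  have hℓ0 : 0 < (1 - 2 * ε) * L := mul_pos (by linarith) hL
  have hWk := fun k : Fin 3 → ℤ => hW n L ε k Ψ.ψ hL hε hε4
  simp only [hWk]
  exact tsum_lintegral_cellFourierCoeff_slice_le hℓ0 _ (fun m : Fin 3 → ℤ => K' < ‖(fun j => (m j : ℝ))‖)
    _ _ Ψ fun u hu => hOB _ K' u hℓ0 hMK hu

end Summit.AtomisticToContinuum.BoseEinsteinCondensation.Theorems.BecUvTail

end
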